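import Mathlib
import Literature.Probability.LatticeModels.ProdBernoulliIndependence
import Literature.Probability.Percolation.ConditionalPositiveAssociation
import Literature.Probability.Percolation.TwoClusterConditionalAssociation
import Literature.Probability.Percolation.PercolationProofs
import Literature.Probability.Percolation.ClusterBoundary
import HarnessLib

/-!
# Terminal separation (the vertex-set two-cluster inequality from BHK Thm. 1.3): `stub_terminalSeparation`

This file proves `stub_terminalSeparation`.

## Content

The implication "van den Berg–Häggström–Kahn 2006, Thm. 1.3 (functional form, `V = Fin n`)
implies the vertex-SET two-cluster inequality": with `μ = prodBernoulli w`, `E = {o ↔ a}`,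
`D = {a ↮ T}`, `Q = {T pairwise separated}`,
`μ(E ∩ D) · μ(D ∩ Q) ≤ μ(D) · μ(E ∩ (D ∩ Q))` (BHK Thm. 1.5 / eq. (9) with the second
vertex replaced by the set `T`; Kozma–Nitzan §2.2 Lemma 1(i)).  Proof, following BHK p. 7:
condition on the vertex cluster `K = C(a)`; off the cluster the configuration is fresh
(independence of events determined by disjoint edge sets,
`prodBernoulli_real_inter_of_determinedBy`), so the conditional probability
`G(C_a) = μ(Q holds using only the edges avoiding K)` is an increasing function of the edge
cluster `C_a`, as is `F(C_a) = 1{a ↔ o}` (`connIndicatorFn`); apply the hypothesis to `F, G` and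
identify the three set integrals by summing over the partition `{C(a) = K}` (`clusterIs a K`).
"`Q` holds using only the edges avoiding `K`" is the event `{ω | ω ∖ edgesTouching K ∈ Q}`, and the
vertex set of an edge set `W` (plus `a`) is `{v | v = a ∨ ∃ e ∈ W, v ∈ e}`.
-/

namespace Summit.CriticalPhenomena.PercolationContinuityZ3.Theorems

open scoped BigOperators Classical
open MeasureTheory Set
open Literature.Probability.LatticeModels (prodBernoulli prodBernoulli_real_inter_of_determinedBy)
open Literature.Probability.Percolation

variable {n : ℕ}

/-! ### Monotonicity of `G` -/

/-- The event "the vertices of `T` are pairwise separated" is decreasing. -/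
private theorem isLowerSet_sep (T : Finset (Fin n)) :
    IsLowerSet {ω : BondConfig (Fin n) | ∀ t ∈ T, ∀ t' ∈ T, t ≠ t' → ω ∉ openConn t t'} := by
  intro ω ω' hle hω t ht t' ht' hne hconn
  exact hω t ht t' ht' hne (isUpperSet_openConn t t' hle hconn)

/-- `edgesTouching` is monotone. -/
private theorem edgesTouching_mono {K K' : Set (Fin n)} (h : K ⊆ K') :
    edgesTouching K ⊆ edgesTouching K' :=
  fun _ ⟨v, hve, hvK⟩ => ⟨v, hve, h hvK⟩

/-- For a decreasing event `Q`, "`Q` holds using only the edges avoiding `K`" is monotone in `K`. -/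
private theorem sepOff_mono {Q : Set (BondConfig (Fin n))} (hQ : IsLowerSet Q) {K K' : Set (Fin n)}
    (h : K ⊆ K') :
    {ω : BondConfig (Fin n) | ω \ edgesTouching K ∈ Q} ⊆ {ω | ω \ edgesTouching K' ∈ Q} :=
  fun _ hω => hQ (sdiff_subset_sdiff_right (edgesTouching_mono h)) hω

/-- The vertex set of an edge set is monotone. -/
private theorem vset_mono (a : Fin n) {W W' : Set (Sym2 (Fin n))} (h : W ⊆ W') :
    {v | v = a ∨ ∃ e ∈ W, v ∈ e} ⊆ {v | v = a ∨ ∃ e ∈ W', v ∈ e} :=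
  fun _ hv => hv.imp id fun ⟨e, he, hve⟩ => ⟨e, h he, hve⟩

/-- `G(W) = μ(Q holds using only the edges avoiding the vertex set of W)` is increasing in `W`
(for `Q` decreasing). -/
private theorem monotone_G (w : Sym2 (Fin n) → unitInterval) {Q : Set (BondConfig (Fin n))}
    (hQ : IsLowerSet Q) (a : Fin n) :
    Monotone fun W : Set (Sym2 (Fin n)) =>
      (prodBernoulli w).real {ω | ω \ edgesTouching {v | v = a ∨ ∃ e ∈ W, v ∈ e} ∈ Q} :=
  fun _ _ h => measureReal_mono (sepOff_mono hQ (vset_mono a h))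

/-! ### On the event `{C(a) = K}` -/

/-- The vertex set of the edge cluster of `a` is the vertex cluster of `a`. -/
private theorem vset_openEdgeCluster (a : Fin n) (ω : BondConfig (Fin n)) :
    {v | v = a ∨ ∃ e ∈ openEdgeCluster ω a, v ∈ e} = openCluster ω a := by
  ext v
  exact (reachable_iff_exists_mem_openEdgeCluster ω a v).symm

/-- On `{C(a) = K}`, `G(C_a ω) = μ(Q holds using only the edges avoiding K)`. -/
private theorem G_openEdgeCluster (w : Sym2 (Fin n) → unitInterval) (Q : Set (BondConfig (Fin n)))
    {a : Fin n} {K : Finset (Fin n)} {ω : BondConfig (Fin n)} (hω : ω ∈ clusterIs a K) :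
    (prodBernoulli w).real
        {ω' | ω' \ edgesTouching {v | v = a ∨ ∃ e ∈ openEdgeCluster ω a, v ∈ e} ∈ Q} =
      (prodBernoulli w).real {ω' | ω' \ edgesTouching (↑K : Set (Fin n)) ∈ Q} := by
  rw [vset_openEdgeCluster, mem_clusterIs.1 hω]

/-- On `{C(a) = K}`: `a ↔ b` iff `b ∈ K`. -/
private theorem mem_openConn_iff_of_mem {a b : Fin n} {K : Finset (Fin n)} {ω : BondConfig (Fin n)}
    (hω : ω ∈ clusterIs a K) : ω ∈ openConn a b ↔ b ∈ K := by
  rw [← Finset.mem_coe, ← mem_clusterIs.1 hω]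
  rfl

/-- On `{C(a) = K}`: `b ↔ a` iff `b ∈ K`. -/
private theorem mem_openConn_symm_iff_of_mem {a b : Fin n} {K : Finset (Fin n)}
    {ω : BondConfig (Fin n)} (hω : ω ∈ clusterIs a K) : ω ∈ openConn b a ↔ b ∈ K := by
  rw [← mem_openConn_iff_of_mem hω]
  exact ⟨fun h => SimpleGraph.Reachable.symm h, fun h => SimpleGraph.Reachable.symm h⟩

/-- On `{C(a) = K}`, `F(C_a ω) = [o ∈ K]` for `F` the increasing function reading `a ↔ o`. -/
private theorem connIndicatorFn_openEdgeCluster_of_mem {a o : Fin n} {K : Finset (Fin n)}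
    {ω : BondConfig (Fin n)} (hω : ω ∈ clusterIs a K) :
    connIndicatorFn a o (openEdgeCluster ω a) = if o ∈ K then 1 else 0 := by
  rw [connIndicatorFn_openEdgeCluster]
  by_cases ho : o ∈ K
  · rw [if_pos ho, indicator_of_mem ((mem_openConn_iff_of_mem hω).2 ho), Pi.one_apply]
  · rw [if_neg ho, indicator_of_notMem (fun h => ho ((mem_openConn_iff_of_mem hω).1 h))]

/-- On `{C(a) = K}`: `a ↮ T` iff `T` misses `K`. -/
private theorem disconn_iff_of_mem {a : Fin n} (T : Finset (Fin n)) {K : Finset (Fin n)}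
    {ω : BondConfig (Fin n)} (hω : ω ∈ clusterIs a K) :
    (∀ t ∈ T, ω ∉ openConn a t) ↔ ∀ t ∈ T, t ∉ K := by
  refine forall₂_congr fun t _ => ?_
  rw [mem_openConn_iff_of_mem hω]

/-- `{a ↮ T} ∩ {C(a) = K}` is `{C(a) = K}` if `T` misses `K`, and empty otherwise. -/
private theorem disconn_inter_clusterIs (a : Fin n) (T K : Finset (Fin n)) :
    {ω | ∀ t ∈ T, ω ∉ openConn a t} ∩ clusterIs a K =
      if (∀ t ∈ T, t ∉ K) then clusterIs a K else ∅ := by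
  ext ω
  split_ifs with h
  · exact ⟨fun hω => hω.2, fun hω => ⟨(disconn_iff_of_mem T hω).2 h, hω⟩⟩
  · simp only [mem_inter_iff, mem_setOf_eq, mem_empty_iff_false, iff_false, not_and]
    exact fun hD hω => h ((disconn_iff_of_mem T hω).1 hD)

/-- `{o ↔ a} ∩ S ∩ {C(a) = K}` is `S ∩ {C(a) = K}` if `o ∈ K`, and empty otherwise. -/
private theorem openConn_inter_inter_clusterIs (o a : Fin n) (K : Finset (Fin n))
    (S : Set (BondConfig (Fin n))) :
    openConn o a ∩ (S ∩ clusterIs a K) = if o ∈ K then S ∩ clusterIs a K else ∅ := by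
  ext ω
  split_ifs with ho
  · exact ⟨fun h => h.2, fun h => ⟨(mem_openConn_symm_iff_of_mem h.2).2 ho, h⟩⟩
  · simp only [mem_inter_iff, mem_empty_iff_false, iff_false, not_and]
    exact fun hE _ hω => ho ((mem_openConn_symm_iff_of_mem hω).1 hE)

/-- An open walk none of whose vertices lies in `K` is open in `ω ∖ edgesTouching K`. -/
private theorem reachable_sdiff_edgesTouching {ω : BondConfig (Fin n)} {K : Set (Fin n)}
    {u v : Fin n} (p : (openGraph ω).Walk u v) (hp : ∀ x ∈ p.support, x ∉ K) :
    (openGraph (ω \ edgesTouching K)).Reachable u v := by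
  refine ⟨p.transfer (openGraph (ω \ edgesTouching K)) fun e he => ?_⟩
  have h1 : e ∈ (openGraph ω).edgeSet := p.edges_subset_edgeSet he
  simp only [openGraph, SimpleGraph.edgeSet_fromEdgeSet, mem_sdiff, mem_setOf_eq, edgesTouching,
    not_exists, not_and] at h1 ⊢
  exact ⟨⟨h1.1, fun z hz hzK => hp z (SimpleGraph.Walk.mem_support_of_mem_edges he hz) hzK⟩,
    h1.2⟩

/-- On `{C(a) = K}` with `T` missing `K`: `T` is pairwise separated iff it is pairwise separated
using only the edges avoiding `K` (an open path between two vertices of `T` cannot touch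
`K = C(a)`, since `a ↮ T`). -/
private theorem sep_iff_sepOff_of_mem {a : Fin n} {T K : Finset (Fin n)} {ω : BondConfig (Fin n)}
    (hω : ω ∈ clusterIs a K) (hTK : ∀ t ∈ T, t ∉ K) :
    ω ∈ {ω : BondConfig (Fin n) | ∀ t ∈ T, ∀ t' ∈ T, t ≠ t' → ω ∉ openConn t t'} ↔
      ω \ edgesTouching (↑K : Set (Fin n)) ∈
        {ω : BondConfig (Fin n) | ∀ t ∈ T, ∀ t' ∈ T, t ≠ t' → ω ∉ openConn t t'} := by
  refine ⟨fun h => isLowerSet_sep T (sdiff_subset (s := ω) (t := edgesTouching ↑K)) h,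
    fun h => ?_⟩
  intro t ht t' ht' hne hconn
  obtain ⟨p⟩ := (hconn : (openGraph ω).Reachable t t')
  refine h t ht t' ht' hne (reachable_sdiff_edgesTouching p fun x hx hxK => ?_)
  have hax : x ∈ openCluster ω a := by rw [mem_clusterIs.1 hω]; exact hxK
  have hat : (openGraph ω).Reachable a t :=
    SimpleGraph.Reachable.trans hax ⟨(p.takeUntil x hx).reverse⟩
  exact hTK t ht ((mem_openConn_iff_of_mem hω).1 hat)

/-- "`Q` holds using only the edges avoiding `K`" is determined by the edges not touching `K`. -/
private theorem determinedBy_sepOff (Q : Set (BondConfig (Fin n))) (K : Set (Fin n)) :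
    DeterminedBy {ω : BondConfig (Fin n) | ω \ edgesTouching K ∈ Q} (edgesTouching K)ᶜ := by
  rw [determinedBy_iff]
  intro ω ω' h
  simp only [mem_setOf_eq, sdiff_eq, h]

/-- Independence of `{C(a) = K}` (determined by the edges touching `K`) and "`Q` holds using only
the edges avoiding `K`" (determined by the other edges). -/
private theorem real_clusterIs_inter_sepOff (w : Sym2 (Fin n) → unitInterval)
    (Q : Set (BondConfig (Fin n))) (a : Fin n) (K : Finset (Fin n)) :
    (prodBernoulli w).real (clusterIs a K ∩ {ω | ω \ edgesTouching (↑K : Set (Fin n)) ∈ Q}) =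
      (prodBernoulli w).real (clusterIs a K) *
        (prodBernoulli w).real {ω | ω \ edgesTouching (↑K : Set (Fin n)) ∈ Q} := by
  refine prodBernoulli_real_inter_of_determinedBy w
    (edgesTouching (↑K : Set (Fin n))).toFinite.toFinset ?_ ?_ MeasurableSet.of_discrete
    MeasurableSet.of_discrete
  · rw [Set.Finite.coe_toFinset]; exact determinedBy_clusterIs a K
  · rw [Set.Finite.coe_toFinset]; exact determinedBy_sepOff Q ↑K

/-! ### Set integrals of functions of the cluster -/

/-- A function constant on each event `{C(a) = K}` integrates over `S` to
`∑_K μ(S ∩ {C(a) = K}) c_K`. -/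
private theorem setIntegral_eq_sum_clusterIs (μ : Measure (BondConfig (Fin n)))
    [IsFiniteMeasure μ] (a : Fin n) (S : Set (BondConfig (Fin n))) (f : BondConfig (Fin n) → ℝ)
    (c : Finset (Fin n) → ℝ) (hf : ∀ K, ∀ ω ∈ clusterIs a K, f ω = c K) :
    ∫ ω in S, f ω ∂μ = ∑ K : Finset (Fin n), μ.real (S ∩ clusterIs a K) * c K := by
  have hS : S = ⋃ K : Finset (Fin n), S ∩ clusterIs a K := by
    ext ω
    simp only [mem_iUnion, mem_inter_iff]
    exact ⟨fun h => ⟨(openCluster ω a).toFinite.toFinset, h, by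
      rw [mem_clusterIs, Set.Finite.coe_toFinset]⟩, fun ⟨_, h, _⟩ => h⟩
  calc ∫ ω in S, f ω ∂μ
      = ∫ ω in ⋃ K : Finset (Fin n), S ∩ clusterIs a K, f ω ∂μ := by rw [← hS]
    _ = ∑ K : Finset (Fin n), ∫ ω in S ∩ clusterIs a K, f ω ∂μ :=
        integral_iUnion_fintype (fun _ => MeasurableSet.of_discrete)
          (fun K K' hKK' => Disjoint.mono inter_subset_right inter_subset_right
            (pairwise_disjoint_clusterIs a hKK'))
          (fun _ => Integrable.of_finite)
    _ = ∑ K : Finset (Fin n), μ.real (S ∩ clusterIs a K) * c K := by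
        refine Finset.sum_congr rfl fun K _ => ?_
        rw [setIntegral_congr_fun MeasurableSet.of_discrete (fun ω hω => hf K ω hω.2),
          setIntegral_const, smul_eq_mul]

/-- Total probability over the values of the cluster: `μ(S) = ∑_K μ(S ∩ {C(a) = K})`. -/
private theorem measureReal_eq_sum_clusterIs (μ : Measure (BondConfig (Fin n)))
    [IsFiniteMeasure μ] (a : Fin n) (S : Set (BondConfig (Fin n))) :
    μ.real S = ∑ K : Finset (Fin n), μ.real (S ∩ clusterIs a K) := by
  have h := setIntegral_eq_sum_clusterIs μ a S (fun _ => (1 : ℝ)) (fun _ => 1) fun _ _ _ => rfl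
  rw [setIntegral_const, smul_eq_mul, mul_one] at h
  rw [h]
  exact Finset.sum_congr rfl fun K _ => mul_one _

section Main

variable (w : Sym2 (Fin n) → unitInterval) (T : Finset (Fin n)) (o a : Fin n)
  {Q : Set (BondConfig (Fin n))}

/-- The termwise identity `μ({a ↮ T} ∩ {C(a) = K}) · μ(Q off K) = μ({a ↮ T} ∩ Q ∩ {C(a) = K})`,
for an event `Q` which on `{C(a) = K}`, `T` missing `K`, holds iff it holds off `K`. -/
private theorem real_disconn_inter_clusterIs_mul
    (hQ : ∀ (K : Finset (Fin n)) (ω : BondConfig (Fin n)), ω ∈ clusterIs a K →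
      (∀ t ∈ T, t ∉ K) → (ω ∈ Q ↔ ω \ edgesTouching (↑K : Set (Fin n)) ∈ Q))
    (K : Finset (Fin n)) :
    (prodBernoulli w).real ({ω | ∀ t ∈ T, ω ∉ openConn a t} ∩ clusterIs a K) *
        (prodBernoulli w).real {ω | ω \ edgesTouching (↑K : Set (Fin n)) ∈ Q} =
      (prodBernoulli w).real ({ω | ∀ t ∈ T, ω ∉ openConn a t} ∩ Q ∩ clusterIs a K) := by
  rw [inter_right_comm, disconn_inter_clusterIs]
  split_ifs with hTK
  · rw [← real_clusterIs_inter_sepOff]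
    congr 1
    ext ω
    exact ⟨fun ⟨hω, hq⟩ => ⟨hω, (hQ K ω hω hTK).2 hq⟩,
      fun ⟨hω, hq⟩ => ⟨hω, (hQ K ω hω hTK).1 hq⟩⟩
  · simp

/-- `∫_{a ↮ T} G(C_a) dμ = μ({a ↮ T} ∩ Q)`. -/
private theorem setIntegral_G
    (hQ : ∀ (K : Finset (Fin n)) (ω : BondConfig (Fin n)), ω ∈ clusterIs a K →
      (∀ t ∈ T, t ∉ K) → (ω ∈ Q ↔ ω \ edgesTouching (↑K : Set (Fin n)) ∈ Q)) :
    ∫ ω in {ω | ∀ t ∈ T, ω ∉ openConn a t},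
        (prodBernoulli w).real
          {ω' | ω' \ edgesTouching {v | v = a ∨ ∃ e ∈ openEdgeCluster ω a, v ∈ e} ∈ Q}
        ∂(prodBernoulli w) =
      (prodBernoulli w).real ({ω | ∀ t ∈ T, ω ∉ openConn a t} ∩ Q) := by
  rw [setIntegral_eq_sum_clusterIs (prodBernoulli w) a {ω | ∀ t ∈ T, ω ∉ openConn a t} _
      (fun K => (prodBernoulli w).real {ω' | ω' \ edgesTouching (↑K : Set (Fin n)) ∈ Q})
      (fun K ω hω => G_openEdgeCluster w Q hω),
    measureReal_eq_sum_clusterIs (prodBernoulli w) a ({ω | ∀ t ∈ T, ω ∉ openConn a t} ∩ Q)]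
  exact Finset.sum_congr rfl fun K _ => real_disconn_inter_clusterIs_mul w T a hQ K

/-- `∫_{a ↮ T} F(C_a) dμ = μ({o ↔ a} ∩ {a ↮ T})`. -/
private theorem setIntegral_connIndicatorFn :
    ∫ ω in {ω | ∀ t ∈ T, ω ∉ openConn a t}, connIndicatorFn a o (openEdgeCluster ω a)
        ∂(prodBernoulli w) =
      (prodBernoulli w).real (openConn o a ∩ {ω | ∀ t ∈ T, ω ∉ openConn a t}) := by
  rw [setIntegral_eq_sum_clusterIs (prodBernoulli w) a {ω | ∀ t ∈ T, ω ∉ openConn a t} _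
      (fun K => if o ∈ K then (1 : ℝ) else 0)
      (fun K ω hω => connIndicatorFn_openEdgeCluster_of_mem hω),
    measureReal_eq_sum_clusterIs (prodBernoulli w) a
      (openConn o a ∩ {ω | ∀ t ∈ T, ω ∉ openConn a t})]
  refine Finset.sum_congr rfl fun K _ => ?_
  rw [inter_assoc, openConn_inter_inter_clusterIs]
  split_ifs <;> simp

/-- `∫_{a ↮ T} F(C_a) G(C_a) dμ = μ({o ↔ a} ∩ ({a ↮ T} ∩ Q))`. -/
private theorem setIntegral_connIndicatorFn_mul_G
    (hQ : ∀ (K : Finset (Fin n)) (ω : BondConfig (Fin n)), ω ∈ clusterIs a K →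
      (∀ t ∈ T, t ∉ K) → (ω ∈ Q ↔ ω \ edgesTouching (↑K : Set (Fin n)) ∈ Q)) :
    ∫ ω in {ω | ∀ t ∈ T, ω ∉ openConn a t},
        connIndicatorFn a o (openEdgeCluster ω a) *
          (prodBernoulli w).real
            {ω' | ω' \ edgesTouching {v | v = a ∨ ∃ e ∈ openEdgeCluster ω a, v ∈ e} ∈ Q}
        ∂(prodBernoulli w) =
      (prodBernoulli w).real (openConn o a ∩ ({ω | ∀ t ∈ T, ω ∉ openConn a t} ∩ Q)) := by
  rw [setIntegral_eq_sum_clusterIs (prodBernoulli w) a {ω | ∀ t ∈ T, ω ∉ openConn a t} _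
      (fun K => (if o ∈ K then (1 : ℝ) else 0) *
        (prodBernoulli w).real {ω' | ω' \ edgesTouching (↑K : Set (Fin n)) ∈ Q})
      (fun K ω hω => by rw [connIndicatorFn_openEdgeCluster_of_mem hω, G_openEdgeCluster w Q hω]),
    measureReal_eq_sum_clusterIs (prodBernoulli w) a
      (openConn o a ∩ ({ω | ∀ t ∈ T, ω ∉ openConn a t} ∩ Q))]
  refine Finset.sum_congr rfl fun K _ => ?_
  rw [inter_assoc, openConn_inter_inter_clusterIs]
  split_ifs with ho
  · rw [one_mul, real_disconn_inter_clusterIs_mul w T a hQ]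
  · simp

end Main

/-- **Terminal separation**: van den Berg–Häggström–Kahn's Theorem 1.3 (functional form, `V = Fin n`) implies the
vertex-SET two-cluster inequality `μ(E ∩ D) · μ(D ∩ Q) ≤ μ(D) · μ(E ∩ (D ∩ Q))`, `E = {o ↔ a}`, `D = {a ↮ T}`,
`Q = {T pairwise separated}`; see the module docstring. -/
theorem stub_terminalSeparation :
    (∀ (n : ℕ) (w : Sym2 (Fin n) → unitInterval) (s : Fin n) (X : Set (Fin n))
      (F G : Set (Sym2 (Fin n)) → ℝ), Monotone F → Monotone G → s ∉ X →
      (∫ ω in {ω : Literature.Probability.Percolation.BondConfig (Fin n) |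
            ∀ x ∈ X, ¬ (Literature.Probability.Percolation.openGraph ω).Reachable s x},
          F (Literature.Probability.Percolation.openEdgeCluster ω s)
            ∂(Literature.Probability.LatticeModels.prodBernoulli w)) *
        (∫ ω in {ω : Literature.Probability.Percolation.BondConfig (Fin n) |
            ∀ x ∈ X, ¬ (Literature.Probability.Percolation.openGraph ω).Reachable s x},
          G (Literature.Probability.Percolation.openEdgeCluster ω s)
            ∂(Literature.Probability.LatticeModels.prodBernoulli w)) ≤
      (Literature.Probability.LatticeModels.prodBernoulli w).real
          {ω : Literature.Probability.Percolation.BondConfig (Fin n) |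
            ∀ x ∈ X, ¬ (Literature.Probability.Percolation.openGraph ω).Reachable s x} *
        ∫ ω in {ω : Literature.Probability.Percolation.BondConfig (Fin n) |
            ∀ x ∈ X, ¬ (Literature.Probability.Percolation.openGraph ω).Reachable s x},
          F (Literature.Probability.Percolation.openEdgeCluster ω s) *
            G (Literature.Probability.Percolation.openEdgeCluster ω s)
            ∂(Literature.Probability.LatticeModels.prodBernoulli w)) →
    ∀ (n : ℕ) (w : Sym2 (Fin n) → unitInterval) (T : Finset (Fin n)) (o a : Fin n),
      (Literature.Probability.LatticeModels.prodBernoulli w).real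
          (Literature.Probability.Percolation.openConn o a ∩
            {ω | ∀ t ∈ T, ω ∉ Literature.Probability.Percolation.openConn a t}) *
        (Literature.Probability.LatticeModels.prodBernoulli w).real
          ({ω | ∀ t ∈ T, ω ∉ Literature.Probability.Percolation.openConn a t} ∩
            {ω | ∀ t ∈ T, ∀ t' ∈ T, t ≠ t' → ω ∉ Literature.Probability.Percolation.openConn t t'}) ≤
      (Literature.Probability.LatticeModels.prodBernoulli w).real
          {ω | ∀ t ∈ T, ω ∉ Literature.Probability.Percolation.openConn a t} *
        (Literature.Probability.LatticeModels.prodBernoulli w).real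
          (Literature.Probability.Percolation.openConn o a ∩
            ({ω | ∀ t ∈ T, ω ∉ Literature.Probability.Percolation.openConn a t} ∩
              {ω | ∀ t ∈ T, ∀ t' ∈ T, t ≠ t' → ω ∉ Literature.Probability.Percolation.openConn t t'})) := by
  intro H n w T o a
  by_cases haT : a ∈ T
  · -- `a ∈ T`: the conditioning event `{a ↮ T}` is empty and both sides vanish
    have hD : {ω : BondConfig (Fin n) | ∀ t ∈ T, ω ∉ openConn a t} = ∅ :=
      Set.subset_empty_iff.1 fun ω hω => hω a haT (SimpleGraph.Reachable.refl a)
    simp [hD]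
  · -- apply the hypothesis to `F = 1{a ↔ o}` and `G = μ(Q off the cluster)`, then identify
    set Q : Set (BondConfig (Fin n)) :=
      {ω | ∀ t ∈ T, ∀ t' ∈ T, t ≠ t' → ω ∉ openConn t t'}
    have hQ : ∀ (K : Finset (Fin n)) (ω : BondConfig (Fin n)), ω ∈ clusterIs a K →
        (∀ t ∈ T, t ∉ K) → (ω ∈ Q ↔ ω \ edgesTouching (↑K : Set (Fin n)) ∈ Q) :=
      fun K ω hω hTK => sep_iff_sepOff_of_mem hω hTK
    have key : (∫ ω in {ω | ∀ t ∈ T, ω ∉ openConn a t}, connIndicatorFn a o (openEdgeCluster ω a)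
          ∂(prodBernoulli w)) *
        (∫ ω in {ω | ∀ t ∈ T, ω ∉ openConn a t},
          (prodBernoulli w).real
            {ω' | ω' \ edgesTouching {v | v = a ∨ ∃ e ∈ openEdgeCluster ω a, v ∈ e} ∈ Q}
          ∂(prodBernoulli w)) ≤
        (prodBernoulli w).real {ω | ∀ t ∈ T, ω ∉ openConn a t} *
          ∫ ω in {ω | ∀ t ∈ T, ω ∉ openConn a t},
            connIndicatorFn a o (openEdgeCluster ω a) *
              (prodBernoulli w).real
                {ω' | ω' \ edgesTouching {v | v = a ∨ ∃ e ∈ openEdgeCluster ω a, v ∈ e} ∈ Q}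
            ∂(prodBernoulli w) :=
      H n w a ↑T (connIndicatorFn a o)
        (fun W => (prodBernoulli w).real {ω | ω \ edgesTouching {v | v = a ∨ ∃ e ∈ W, v ∈ e} ∈ Q})
        (monotone_connIndicatorFn a o) (monotone_G w (isLowerSet_sep T) a)
        (fun h => haT (Finset.mem_coe.1 h))
    rw [setIntegral_connIndicatorFn w T o a, setIntegral_G w T a hQ,
      setIntegral_connIndicatorFn_mul_G w T o a hQ] at key
    exact key

end Summit.CriticalPhenomena.PercolationContinuityZ3.Theorems
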